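import Literature.RepresentationTheory.HarrisKudlaSweet1996.GlobalSplittingCharactersQuadExt
import Literature.NumberTheory.Automorphic.ClassFieldCharacterLocal
import Literature.NumberTheory.Automorphic.HeckeCharacterLocalComponentSmooth
import Literature.NumberTheory.Automorphic.AdicCompletionDegreeOnePlaceEquiv
import Literature.NumberTheory.Automorphic.UnitaryGroupSplitPlace
import Literature.NumberTheory.Automorphic.QuadraticLocalBaseChange
import Literature.NumberTheory.GaloisRepresentations.HeckeCharacterCofiniteProofs
import Literature.NumberTheory.QuadraticForms.HilbertReciprocityFiniteness
import Mathlib.Analysis.Normed.Ring.Units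
import HarnessLib

/-!
# Local components of a global splitting character `χ|_{𝕀_F} = ε_{E/F}` of an ARBITRARY quadratic extension
([HarrisKudlaSweet1996, §1 (1.5), (1.15)]: `χ_V|_{F^×} = ε^m_{E/F}`, read at the finite places of `F`)

Topic `NumberTheory/GelbartRogawski1991`; namespace
`Literature.NumberTheory.GelbartRogawski1991.UnitaryDualPair.LocalSplitting.QuadExt`. KERNEL only: proved theorems;
no definition, no named fact, no `sorry`.

For a quadratic extension `E/F` of number fields with an `F`-automorphism `c` of `E` and `δ ∈ E` with
`c δ = -δ ≠ 0`, `δ² = d ∈ F` (so `c` is the non-trivial automorphism and `E = F(δ)`), a Hecke character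
`χ : 𝕀_E → ℂˣ` and a finite place `v` of `F`, write `χ_w = χ.localComponent w` (`w ∣ v`) and `ι_w = toPlace v w :
F_v → E_w`.  This file supplies, in tree vocabulary and at the printed generality (every quadratic `E/F`), the LOCAL
hypotheses on the family `χv w := χ_w⁻¹` under which the GR-1 local package of [GelbartRogawski1991, Prop. 3.1.1]
(`LocalDoubledUnitarySplittingData`, `…Split`) constructs Kudla's splitting at `v` (`IsEpsilonChar`, `IsSplitPair`,
the cofinite unramified clause of `eventually_isGoodPlace`; `IsTrivialNearOne` is
`eventually_localComponent_inv_unit_eq_one` of `CMSplittingCharLocalComponents.lean` §1, already stated for any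
number field):

* `eventually_forall_placesOver_localComponent_inv_eq_one` — **for all but finitely many `v`, every `χ_w`, `w ∣ v`,
  is trivial on the units** (`isUnramifiedAt_cofinite_holds`, finitely many `v` below the ramified `w`);
* `placesOver_eq_of_smul_eq`, `ideleBaseChange_localUnits_of_smul_eq` ∕ `_of_smul_ne` — the base change of the local
  idèle `⟨a⟩_v` is `⟨ι_w a⟩_w` at a NON-SPLIT `v` (`c • w = w`: `w` is the only place above `v`) and
  `⟨ι_w a⟩_w ⟨ι_w̄ a⟩_w̄` at a SPLIT `v` (`w̄ = c⁻¹ • w ≠ w`) — tree `ideleBaseChange_localUnits`,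
  `PlacesOver.eq_or_eq_galInv`;
* `isSquare_of_smul_ne` — at a split `v`, `d` is a square in `F_v` (`ι_w : F_v ≅ E_w` is onto at a place of degree
  one, tree `AdicCompletionDegreeOnePlaceEquiv`), so `ε_v = (d, ·)_v = 1`;
* **`localComponent_inv_toPlace_eq_hilbertSymbol`** — for `χ|_{𝕀_F} = ε_{E/F}` (`IsSplittingCharExt F E 1 χ`) and
  `v` NON-SPLIT: `χ_w⁻¹(ι_w a) = (d, a)_v` for all `a ∈ F_vˣ` (`χ_w(ι_w a) = χ(⟨a⟩_v ⊗ 1) = ε(⟨a⟩_v) = (d, a)_v`,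
  `quadraticHeckeCharExt_localUnits`) — the hypothesis `IsEpsilonChar` of the local package;
* **`localComponent_galInv_inv_eq`** — for `χ|_{𝕀_F} = ε_{E/F}` and `v` SPLIT: `χ_{w̄}(x)⁻¹ = χ_w(c_* x)` for all
  `x ∈ E_{w̄}ˣ`, `c_* : E_{w̄} → E_w` the transport (`x = ι_{w̄} a`, `c_* ι_{w̄} = ι_w`, `χ_w(ι_w a) χ_{w̄}(ι_{w̄} a) =
  ε_v(a) = 1`) — the hypothesis `IsSplitPair` of the local package.

The CM case `(F, E, c, δ) = (L⁺, L, complexConj, imagUnit L)` is `CMSplittingCharLocalComponents.lean` §CM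
(there with `IsSplittingChar L 1 χ`, which is `IsSplittingCharExt L⁺ L 1 χ` by `isSplittingChar_iff_isSplittingCharExt`).

Written for the general-`(F, E, σ)` programme of the kernel proof of [GelbartRogawski1991, Prop. 3.1.1]
(`Prop311AsPrinted`; seat GR-1 of the Hodge-CM cell).  Nothing in this file is a claim of the manuscripts
adjudicated by that cell.

## References

* M. Harris, S. S. Kudla, W. J. Sweet, *Theta dichotomy for unitary groups*, J. Amer. Math. Soc. 9 (1996), §1 (1.5),
  (1.15) [HarrisKudlaSweet1996].
* J. Tate, *Global class field theory*, Ch. VII of Cassels–Fröhlich (1967), Prop. 1.2, §4.3, §6 (local components)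
  [CasselsFrohlichANT1967].
* O. T. O'Meara, *Introduction to Quadratic Forms* (1963), §63B, §65A, §71D [Omeara1963].
-/

set_option autoImplicit false

noncomputable section

open NumberField IsDedekindDomain Filter
open Literature.NumberTheory.Automorphic Literature.NumberTheory.Automorphic.UnitaryGroup
open Literature.NumberTheory.GaloisRepresentations Literature.NumberTheory.QuadraticForms
open Literature.RepresentationTheory.HarrisKudlaSweet1996

namespace Literature.NumberTheory.GelbartRogawski1991.UnitaryDualPair.LocalSplitting.QuadExt

variable (F : Type) [Field F] [NumberField F] (E : Type) [Field E] [NumberField E] [Algebra F E]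
  [Algebra.IsQuadraticExtension F E] (c : E ≃ₐ[F] E)
  {δ : E} (hcδ : c δ = -δ) (hδ : δ ≠ 0) {d : F} (hd : δ * δ = algebraMap F E d)

/-! ## §1 Unramified at almost all places (any extension `E/F`) -/

omit [NumberField F] [Algebra.IsQuadraticExtension F E] in
/-- **for all but finitely many finite places `v` of `F`, `χ_w` is trivial on the units `𝒪_wˣ` for every `w ∣ v`**
(a Hecke character is unramified outside a finite set of places of `E`, below which lie finitely many places of
`F`). [cite: CasselsFrohlichANT1967, Ch. VII §4.3] -/
theorem eventually_forall_placesOver_localComponent_inv_eq_one (χ : HeckeCharacter E) :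
    ∀ᶠ v : HeightOneSpectrum (𝓞 F) in cofinite, ∀ (w : PlacesOver E v) (u : (w.1.adicCompletion E)ˣ),
      ValuativeRel.valuation (w.1.adicCompletion E) (u : w.1.adicCompletion E) = 1 → (χ.localComponent w.1)⁻¹ u = 1 := by
  have hfin : {w : HeightOneSpectrum (𝓞 E) | ¬ χ.IsUnramifiedAt w}.Finite :=
    Filter.eventually_cofinite.1 (HeckeCharacter.isUnramifiedAt_cofinite_holds χ)
  refine Filter.eventually_cofinite.2 ((hfin.image fun w => w.under (𝓞 F)).subset ?_)
  intro v hv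
  rw [Set.mem_setOf_eq] at hv
  push Not at hv
  obtain ⟨w, u, hu, hne⟩ := hv
  refine ⟨w.1, fun hunr => hne ?_, w.2⟩
  rw [MonoidHom.inv_apply, HeckeCharacter.IsUnramifiedAt.localComponent_eq_one_of_valuation_eq_one hunr hu, inv_one]

/-! ## §2 The places above `v`: base change of local idèles -/

omit [NumberField F] [Algebra.IsQuadraticExtension F E] in
include hcδ hδ in
/-- `c ≠ 1` (since `c δ = −δ` with `δ ≠ 0`, characteristic `0`). [cite: CasselsFrohlichANT1967, Ch. VII Prop. 1.2] -/
theorem algEquiv_ne_one : c ≠ 1 := by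
  intro h1; apply hδ
  have h2 : (2 : E) * δ = 0 := by
    have : δ = -δ := by simpa [h1] using hcδ
    linear_combination this
  exact (mul_eq_zero.1 h2).resolve_left two_ne_zero

variable (v : HeightOneSpectrum (𝓞 F))

include hcδ hδ in
/-- at a NON-SPLIT place (`c • w = w`) `w` is the only place above `v` (`Gal(E/F) = {1, c}` is transitive on the
fibre). [cite: CasselsFrohlichANT1967, Ch. VII Prop. 1.2 (ii)] -/
theorem placesOver_eq_of_smul_eq (w : PlacesOver E v) (hw : c • w.1 = w.1) (w' : PlacesOver E v) :
    w' = w := by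
  rcases PlacesOver.eq_or_eq_galInv c (algEquiv_ne_one F E c hcδ hδ) w w' with h | h
  · exact h
  · rw [h]
    apply Subtype.ext
    change c⁻¹ • w.1 = w.1
    conv_lhs => rw [← hw]
    rw [inv_smul_smul]

include hcδ hδ in
/-- **base change of a local idèle at a non-split place**: `⟨a⟩_v ⊗ 1 = ⟨ι_w a⟩_w`.
[cite: CasselsFrohlichANT1967, Ch. VII §4.3] -/
theorem ideleBaseChange_localUnits_of_smul_eq (w : PlacesOver E v) (hw : c • w.1 = w.1)
    (a : (v.adicCompletion F)ˣ) :
    AdeleRing.ideleBaseChange F E (localUnits v a) =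
      localUnits w.1 (Units.map (toPlace v w : v.adicCompletion F →* w.1.adicCompletion E) a) := by
  classical
  have hT : ∀ w' : HeightOneSpectrum (𝓞 E), w' ∈ ({w.1} : Finset (HeightOneSpectrum (𝓞 E))) ↔ w'.under (𝓞 F) = v :=
    fun w' => ⟨fun h => by rw [Finset.mem_singleton.1 h]; exact w.2,
      fun h => Finset.mem_singleton.2 (congrArg Subtype.val (placesOver_eq_of_smul_eq F E c hcδ hδ v w hw ⟨w', h⟩))⟩
  have h := ideleBaseChange_localUnits (F := F) (E := E) v a
    (fun w' => if h : w'.under (𝓞 F) = v then Units.map (toPlace v ⟨w', h⟩ : v.adicCompletion F →* w'.adicCompletion E) a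
      else 1)
    (fun w' h _ => by rw [dif_pos h, Units.coe_map]; rfl) {w.1} hT
  rw [h, Finset.prod_singleton, dif_pos w.2]

include hcδ hδ in
/-- **base change of a local idèle at a split place**: `⟨a⟩_v ⊗ 1 = ⟨ι_w a⟩_w ⟨ι_w̄ a⟩_w̄`, `w̄ = c⁻¹ • w ≠ w`.
[cite: CasselsFrohlichANT1967, Ch. VII §4.3] -/
theorem ideleBaseChange_localUnits_of_smul_ne (w : PlacesOver E v) (hw : c • w.1 ≠ w.1)
    (a : (v.adicCompletion F)ˣ) :
    AdeleRing.ideleBaseChange F E (localUnits v a) =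
      localUnits w.1 (Units.map (toPlace v w : v.adicCompletion F →* w.1.adicCompletion E) a) *
        localUnits (PlacesOver.galInv c w).1
          (Units.map (toPlace v (PlacesOver.galInv c w) :
            v.adicCompletion F →* (PlacesOver.galInv c w).1.adicCompletion E) a) := by
  classical
  set wb := PlacesOver.galInv c w with hwb
  have hne : w.1 ≠ wb.1 := fun h => PlacesOver.galInv_ne c w hw (Subtype.ext h).symm
  have hT : ∀ w' : HeightOneSpectrum (𝓞 E), w' ∈ ({w.1, wb.1} : Finset (HeightOneSpectrum (𝓞 E))) ↔ w'.under (𝓞 F) = v :=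
    fun w' => ⟨fun h => by
        rcases Finset.mem_insert.1 h with h | h
        · rw [h]; exact w.2
        · rw [Finset.mem_singleton.1 h]; exact wb.2,
      fun h => by
        rcases PlacesOver.eq_or_eq_galInv c (algEquiv_ne_one F E c hcδ hδ) w ⟨w', h⟩ with h' | h'
        · exact Finset.mem_insert.2 (Or.inl (congrArg Subtype.val h'))
        · exact Finset.mem_insert.2 (Or.inr (Finset.mem_singleton.2 (congrArg Subtype.val h')))⟩
  have h := ideleBaseChange_localUnits (F := F) (E := E) v a
    (fun w' => if h : w'.under (𝓞 F) = v then Units.map (toPlace v ⟨w', h⟩ : v.adicCompletion F →* w'.adicCompletion E) a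
      else 1)
    (fun w' h _ => by rw [dif_pos h, Units.coe_map]; rfl) {w.1, wb.1} hT
  rw [h, Finset.prod_pair hne, dif_pos w.2, dif_pos wb.2]

include hd in
/-- **at a split place `d = δ²` is a square in `F_v`**: `ι_w : F_v → E_w` is onto (degree one), and `d = δ²` in
`E`. [cite: CasselsFrohlichANT1967, Ch. VII §4.3; Omeara1963, §65A] -/
theorem isSquare_of_smul_ne (w : PlacesOver E v) (hw : c • w.1 ≠ w.1) :
    IsSquare ((d : F) : v.adicCompletion F) := by
  obtain ⟨he, hf⟩ := ramificationIdx_eq_one_and_inertiaDeg_eq_one_of_smul_ne (F := F) c hw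
  haveI := PlacesOver.liesOver w
  obtain ⟨β, hβ⟩ := (bijective_adicCompletionOfLiesOver_of_degree_one F E v w.1 he hf).2
    ((δ : E) : w.1.adicCompletion E)
  refine ⟨β, (toPlace v w).injective ?_⟩
  rw [map_mul]
  change toPlace v w ((d : F) : v.adicCompletion F) =
    adicCompletionOfLiesOver F E v w.1 β * adicCompletionOfLiesOver F E v w.1 β
  rw [toPlace_coe, ← hd, hβ]
  change algebraMap E (w.1.adicCompletion E) (δ * δ) = algebraMap E (w.1.adicCompletion E) δ * algebraMap E (w.1.adicCompletion E) δ
  rw [map_mul]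

variable {F E v}

/-! ## §3 The two local hypotheses of the GR-1 package -/

include hcδ hδ hd in
/-- **THE NON-SPLIT LOCAL COMPONENT OF A SPLITTING CHARACTER IS THE QUADRATIC CHARACTER `(d, ·)_v`** (hypothesis
`IsEpsilonChar` of the GR-1 package, for `χv w := χ_w⁻¹`): if `χ|_{𝕀_F} = ε_{E/F}` and `c • w = w`, then
`χ_w⁻¹(ι_w a) = (d, a)_v` for every `a ∈ F_vˣ`.
[cite: HarrisKudlaSweet1996, §1 (1.5), (1.15); Omeara1963, §63B, §65A] -/
theorem localComponent_inv_toPlace_eq_hilbertSymbol (χ : HeckeCharacter E) (hχ : IsSplittingCharExt F E 1 χ)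
    (w : PlacesOver E v) (hw : c • w.1 = w.1) (a : (v.adicCompletion F)ˣ) :
    ((((χ.localComponent w.1)⁻¹ : (w.1.adicCompletion E)ˣ →* ℂˣ)
        (Units.map (toPlace v w : v.adicCompletion F →* w.1.adicCompletion E) a) : ℂˣ) : ℂ) =
      hilbertSymbol (v.adicCompletion F) ((d : F) : v.adicCompletion F) (a : v.adicCompletion F) := by
  have key := hχ (localUnits v a)
  rw [pow_one, ideleBaseChange_localUnits_of_smul_eq F E c hcδ hδ v w hw a] at key
  -- `χ_w(ι_w a) = ε(⟨a⟩_v) = (d, a)_v`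
  have hval : (((χ.localComponent w.1) (Units.map (toPlace v w : v.adicCompletion F →* w.1.adicCompletion E) a) : ℂˣ) : ℂ) =
      (hilbertSymbol (v.adicCompletion F) ((d : F) : v.adicCompletion F) (a : v.adicCompletion F) : ℂ) := by
    rw [HeckeCharacter.localComponent_apply, key]
    exact quadraticHeckeCharExt_localUnits c hcδ hδ hd v a
  rw [MonoidHom.inv_apply, Units.val_inv_eq_inv_val, hval]
  rcases hilbertSymbol_eq_one_or_eq_neg_one ((d : F) : v.adicCompletion F) (a : v.adicCompletion F) with h | h
  · rw [h]; norm_num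
  · rw [h]; norm_num

include hcδ hδ hd in
/-- **THE TWO LOCAL COMPONENTS ABOVE A SPLIT PLACE OF A SPLITTING CHARACTER ARE TIED** (hypothesis `IsSplitPair` of
the GR-1 package, for `χv w := χ_w⁻¹`): if `χ|_{𝕀_F} = ε_{E/F}` and `c • w ≠ w`, then for every `x ∈ E_{w̄}ˣ`
(`w̄ = c⁻¹ • w`): `χ_{w̄}⁻¹(x) = (χ_w⁻¹(c_* x))⁻¹`, `c_* : E_{w̄} ≃ E_w` the transport of structure along `c`
(`ε_v = (d, ·)_v = 1` at a split place). [cite: HarrisKudlaSweet1996, §1 (1.5), (1.15)] -/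
theorem localComponent_galInv_inv_eq (χ : HeckeCharacter E) (hχ : IsSplittingCharExt F E 1 χ)
    (w : PlacesOver E v) (hw : c • w.1 ≠ w.1)
    (x : ((PlacesOver.galInv c w).1.adicCompletion E)ˣ) :
    ((χ.localComponent (PlacesOver.galInv c w).1)⁻¹ :
        ((PlacesOver.galInv c w).1.adicCompletion E)ˣ →* ℂˣ) x =
      (((χ.localComponent w.1)⁻¹ : (w.1.adicCompletion E)ˣ →* ℂˣ)
        (Units.map (galAdicCompletionMap c
          (smul_inv_smul c w.1)).toMonoidHom x))⁻¹ := by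
  -- `x = ι_{w̄} a`: `ι_{w̄}` is onto at the split place
  have hwb' : c • (PlacesOver.galInv c w).1 ≠ (PlacesOver.galInv c w).1 := by
    change c • c⁻¹ • w.1 ≠ c⁻¹ • w.1
    rw [smul_inv_smul]
    intro h
    exact hw (by conv_lhs => rw [h]; exact smul_inv_smul c w.1)
  obtain ⟨he, hf⟩ := ramificationIdx_eq_one_and_inertiaDeg_eq_one_of_smul_ne (F := F) c hwb'
  haveI := PlacesOver.liesOver (PlacesOver.galInv c w)
  have hsurj := (bijective_adicCompletionOfLiesOver_of_degree_one F E v (PlacesOver.galInv c w).1 he hf).2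
  obtain ⟨a₀, ha₀⟩ := hsurj (x : (PlacesOver.galInv c w).1.adicCompletion E)
  have ha₀u : IsUnit a₀ := by
    rw [isUnit_iff_ne_zero]
    rintro rfl
    exact x.ne_zero (by rw [← ha₀, map_zero])
  have hax : Units.map (toPlace v (PlacesOver.galInv c w) : v.adicCompletion F →* (PlacesOver.galInv c w).1.adicCompletion E) ha₀u.unit = x :=
    Units.ext (by rw [Units.coe_map, IsUnit.unit_spec]; exact ha₀)
  -- `χ(⟨a⟩_v ⊗ 1) = ε_v(a) = (d, a)_v = 1`
  have key := hχ (localUnits v ha₀u.unit)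
  rw [pow_one, ideleBaseChange_localUnits_of_smul_ne F E c hcδ hδ v w hw, _root_.map_mul] at key
  have hε : ((quadraticHeckeCharExt F E (localUnits v ha₀u.unit) : ℂˣ) : ℂ) = 1 := by
    have hd0 : ((d : F) : v.adicCompletion F) ≠ 0 := by
      have hd0' : d ≠ 0 := by
        rintro rfl
        rw [map_zero, mul_self_eq_zero] at hd
        exact hδ hd
      exact (_root_.map_ne_zero (algebraMap F (v.adicCompletion F))).2 hd0'
    rw [quadraticHeckeCharExt_localUnits c hcδ hδ hd v,
      hilbertSymbol_eq_one_of_isSquare (isSquare_of_smul_ne F E c hd v w hw) hd0]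
    norm_num
  have key' : χ (localUnits w.1 (Units.map (toPlace v w : v.adicCompletion F →* w.1.adicCompletion E) ha₀u.unit)) *
      χ (localUnits (PlacesOver.galInv c w).1 (Units.map (toPlace v (PlacesOver.galInv c w) : v.adicCompletion F →* (PlacesOver.galInv c w).1.adicCompletion E) ha₀u.unit)) = 1 := by
    rw [key]
    exact Units.ext (by rw [hε, Units.val_one])
  -- `c_* (ι_{w̄} a) = ι_w a`
  have hcx : Units.map (galAdicCompletionMap c (smul_inv_smul c w.1)).toMonoidHom x =
      Units.map (toPlace v w : v.adicCompletion F →* w.1.adicCompletion E) ha₀u.unit := by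
    rw [← hax, ← MonoidHom.comp_apply, ← Units.map_comp]
    exact Units.ext (galAdicCompletionMap_toPlace c (PlacesOver.galInv c w) w (smul_inv_smul c w.1) _)
  rw [hcx, MonoidHom.inv_apply, MonoidHom.inv_apply, inv_inv, HeckeCharacter.localComponent_apply,
    HeckeCharacter.localComponent_apply, ← hax]
  exact inv_eq_of_mul_eq_one_left key'

end Literature.NumberTheory.GelbartRogawski1991.UnitaryDualPair.LocalSplitting.QuadExt

end
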